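import Literature.MathematicalPhysics.QuantumFieldTheory.Balaban1983to89.B9GraphZdDegree
import Literature.MathematicalPhysics.QuantumFieldTheory.Balaban1983to89.B6Ineq261LevelGap

/-!
# `Balaban1983to89.B9Lemma21RowLetterZd` — [Balaban1984PropagatorsII] Lemma 2.1 (2.61) p. 234 «sup_{y∈𝔅} Σ_{y′∈𝔅} e^{−αδ₀d(y,y′)} ≤ c₁(α)» IN PRINT'S REGIME
# («RM sufficiently large», (2.59)) ON THE `ℤᵈ` FRAME OF THE [B9] JUNCTION: the block graph `graphZd L x` of a member satisfies the three hypotheses of the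
# tree's GENERIC (2.61) engine `B6Ineq261LevelGap.sum_exp_dist_le_max` — walk form of (2.2) (`LevelGap`, from this seat's (2.60) `length_ge_of_levels`),
# coarse-scale bonds (block corners of touching blocks differ by at most the larger side), per-level packing (corners of level-`j` blocks run over `Lʲ·ℤᵈ`) — hence
# the ROW LETTER `Σ_v e^{−σ·d(u,v)} ≤ K261 N₀ d L 1 σ` with a MEMBER-UNIFORM constant, for every rate `σ` and every member with `R·⌈M⌉ ≥ N₀`, `σ·N₀ > 2d·log L`

statement-level skeleton of published theorems with citation tags; proofs where landed; nothing here is a claim about the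
Yang–Mills mass gap

PDF held: `paper:balaban1984-cmp96-propagators-rt-ii` ([4] of [B9]; journal page = PDF page + 222): p. 233 (2.57)–(2.59) «Now we require that RM is sufficiently
large», p. 234 Lemma 2.1 (2.60)–(2.61) (page images + text layer `p0011.txt`∕`p0012.txt` read by this seat 2026-08-28); [B9] = [Balaban1985BackgroundPropagators]
p. 397 «the weighted distance d(y, y′) defined by (2.46) in [4]», p. 398 l. 17–20 «using Lemma 2.1 of [4]».  BY NAME: `B6Ineq261LevelGap` (lit-balaban p29: the generic
engine `sum_exp_dist_le_max`, the constant `K261`, `summable_K261`, `partialSum_le_K261`, `K261_le_closedForm`, `theta_lt_one_of_log`), `B6Geometry.LevelGap`,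
`B9Lemma21ShellCrossingZd.length_ge_of_levels` ((2.60), this seat), `B9GraphZdDegree.adj_corner_bounds` (this seat), the frame `B9SupplySockB9P3ZdFrame` (dag-n06-e).

WHY THIS FILE (cell `pub-ymgap`, HUMAN RULING D-0062 ∕ D-0149; seat `pub-ymgap-dag-n06-w2` (g2), node N06 = [B9], START-LIST v8 §n06 item 4 «Lemma 2.1 Hölder
summation»; INTENT-8; count-neutral).  Every local-to-global summation at the `ℤᵈ` frame (`B9Eq347GlobalFromLocalZd`, `B9Eq343HolderBothZdFinite.holderBoth_msup_le_CH`
letter `hS`, `B9Eq343HolderDelta2ZdFinite`) displays the row letter `∀ u, Σ_v e^{−κ·distZd(u,v)} ≤ S`.  So far the tree inhabits it on the frame only with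
`S = |𝔅|` (g0, member-dependent) or in the crude regime `κ > log(3^d + 2(L+2)^d + 1)` (`B9GraphZdBallGrowth`, NOT met by [B9]'s rates).  Print's Lemma 2.1 gives it
for EVERY rate once `RM` is large ((2.59)); the tree already holds that mechanism as a generic theorem over zoned graphs (`B6Ineq261LevelGap`, proved for the
large-field cube systems).  This file checks the engine's three hypotheses for the [B9] junction's own block graph and reads off the member-UNIFORM row letter —
the `S` of the Hölder∕sup summations no longer depends on the member.

WHAT IS PROVED (0 sorry; proof lane — no `def`; the corner position of a block `v = (j, z)` is written out as `fun μ => (L:ℝ)^j · z_μ ∈ ℝᵈ`, sup metric).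
* §1 ★ `dist_corner_le_of_adj` — touching blocks: `dist(corner u, corner v) ≤ L^{max(j_u, j_v)}` (coarse-scale bond form of the engine, from `adj_corner_bounds`).
* §2 ★ `levelGap_graphZd` — `B6Geometry.LevelGap (graphZd L x) level N₀` for every `N₀ ≤ R·⌈M⌉` (`Sep22Zd R`, laws (T)(V), `1 ≤ L`): (2.60) in walk form.
* §3 ★ `pack_level` — a finite set of level-`j` blocks whose corners lie within sup-distance `ρ` of a point has at most `(2ρ∕Lʲ + 1)^d` elements.
* §4 ★★★ `rowSum261_graphZd` — for a member with `Sep22Zd R x`, laws (T)(V), connected block graph, and `N₀ ≥ 1` with `N₀ ≤ R·⌈M⌉` and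
  `e^{−σ}·L^{2d∕N₀} < 1`: `Σ_{v∈S} e^{−σ·distZd(y,v)} ≤ K261 N₀ d L 1 σ` for every block `y` and every finite set `S` of blocks — the constant depends on
  `(d, L, σ, N₀)` only, NOT on the member `(M, i, m)`; `rowSum261_graphZd_of_log` (regime in print's logarithmic shape `2d·log L < σ·N₀`);
  `rowSum261_graphZd_closedForm` (`≤ 3·3^d·L^{2d}·(d+1)!∕(1−θ)^{d+2}`, `θ = e^{−σ}L^{2d∕N₀}`); on a finite member `rowLetter261_univ` (`Σ_v` over all blocks) and
  ★ `rowLetter261_hS` — literally the letter `hS` of `holderBoth_msup_le_CH` ∕ the `−3` summations at rate `δ₀ − κ₂`, member-uniformly.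
HONEST SCOPE.  (i) The constant is the engine's `K261` — explicit, finite under the (2.59)-shape condition, but `L`-DEPENDENT (packing count), whereas print states
`c₁(α) = 12c₀^d(½α)` free of `L` (recorded REFUTED-AS-PRINTED on the torus lineage, `B6Lemma21Counterexample`; the `L`-free repaired constants live on the towers);
for the [B9] consumers the value is immaterial (fixed `d, L`).  (ii) (2.2) enters as `Sep22Zd` through (2.60); CONNECTIVITY of the block graph is a hypothesis (g0's
located (L1): `distZd = 0` off components) — its derivation from a cover law is the law owners'.  (iii) This makes the row letter member-uniform; the Hölder exchange
letter `hexH` still carries the frame's `η`-scale `cutHZd` (located (L-H2)) — so the Hölder constant `CH` of `B9Eq343HolderDelta2ZdFinite` is NOT yet member-uniform;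
the sup-norm (`γ = −3`) summations are.  Count-neutral; N05∕N06 NOT discharged; one finite lattice programme at fixed `ε`; R4 closes the conditional finite-𝕋⁴ rung
`BalabanLadder.UV` only; nothing continuum ∕ ℝ⁴ ∕ OS ∕ mass-gap ∕ Clay.  Unit `pub-ymgap-dag-n06-w2` (g2), 2026-08-28.
-/

namespace Literature.MathematicalPhysics.QuantumFieldTheory.Balaban1983to89.B9Lemma21RowLetterZd

open B8LeafModelZd (ZdIdx)
open B9SupplySockB9P3ZdFrame (MemberZd BSite blockZd Touch graphZd distZd Sep22Zd)
open B6Geometry (LevelGap)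
open B6Ineq261LevelGap (F261 K261 sum_exp_dist_le_max summable_K261 partialSum_le_K261 K261_le_closedForm theta_lt_one_of_log)

-- `Site` alone could resolve to the torus sites of `Setup.lean`; re-export the `ℤ^d` sites of `B7Prop1Explicit`.
export B7Prop1Explicit (Site)

variable {d L : ℕ} {x : MemberZd d L}
  (hT : ∀ y : BSite L x, blockZd L y.1.1 y.1.2 ⊆ x.i.Ω y.1.1)
  (hV : ∀ (y : BSite L x) (z : Site d), z ∈ blockZd L y.1.1 y.1.2 → ∀ j, j ≤ x.m → z ∈ x.i.Ω j → j ≤ y.1.1)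

/-! ## §1 Coarse-scale bonds: corners of touching blocks -/

/-- ★ **TOUCHING BLOCKS HAVE CORNERS AT SUP-DISTANCE AT MOST THE LARGER SIDE**: for adjacent blocks `u = (j, z)`, `v = (j′, z′)` of the block graph,
`dist((Lʲz_μ)_μ, (L^{j′}z′_μ)_μ) ≤ L^{max(j, j′)}` in `ℝᵈ` with the sup metric — the engine's coarse-scale bond hypothesis («a part of Γ contained in Bʲ(Λ_j)
consists of bonds of the lattice Λ_j», read at the coarser of the two scales across an interface). [cite: Balaban1984PropagatorsII, (2.46) p.231; Balaban1985BackgroundPropagators, p.397 (Δ(y) = Bʲ(y))] -/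
theorem dist_corner_le_of_adj (hL : 1 ≤ L) {u v : BSite L x} (h : (graphZd L x).Adj u v) :
    dist (fun μ : Fin d => ((L : ℝ) ^ u.1.1 * (u.1.2 μ : ℝ))) (fun μ => ((L : ℝ) ^ v.1.1 * (v.1.2 μ : ℝ))) ≤
      (L : ℝ) ^ max u.1.1 v.1.1 := by
  refine (dist_pi_le_iff (by positivity)).2 fun μ => ?_
  obtain ⟨h1, h2⟩ := B9GraphZdDegree.adj_corner_bounds h.2 μ
  have hLz : (1 : ℤ) ≤ L := by exact_mod_cast hL
  have hu : (L : ℤ) ^ u.1.1 ≤ (L : ℤ) ^ max u.1.1 v.1.1 := pow_le_pow_right₀ hLz (le_max_left _ _)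
  have hv : (L : ℤ) ^ v.1.1 ≤ (L : ℤ) ^ max u.1.1 v.1.1 := pow_le_pow_right₀ hLz (le_max_right _ _)
  have key : |(L : ℤ) ^ u.1.1 * u.1.2 μ - (L : ℤ) ^ v.1.1 * v.1.2 μ| ≤ (L : ℤ) ^ max u.1.1 v.1.1 :=
    abs_le.2 ⟨by linarith, by linarith⟩
  have key' := (Int.cast_le (R := ℝ)).2 key
  push_cast at key'
  rw [Real.dist_eq]
  exact key'

/-! ## §2 The walk form of (2.2): `LevelGap` from (2.60) -/

include hT hV in
/-- ★ **(2.60) ⇒ THE ENGINE's `LevelGap`**: under `Sep22Zd R x`, laws (T)(V) and `1 ≤ L`, every walk of the block graph from a block of level `< i` to a block of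
level `> i` has at least `N₀ + 1` bonds, for every `N₀ ≤ R·⌈M⌉` (`length_ge_of_levels`: the levels differ by `≥ 2`, so the walk is `≥ R⌈M⌉·1 + 1` long).
[cite: Balaban1984PropagatorsII, Lemma 2.1 (2.60) p.234, (2.2) p.224, (2.57) p.233] -/
theorem levelGap_graphZd (hL : 1 ≤ L) {R : ℕ} (hsep : Sep22Zd R x) {N₀ : ℕ} (hN₀ : N₀ ≤ R * ⌈x.M⌉₊) :
    LevelGap (graphZd L x) (fun v : BSite L x => v.1.1) N₀ := by
  intro i u w hu hw p
  have hgap : u.1.1 + 2 ≤ w.1.1 := by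
    have h1 : u.1.1 < i := hu
    have h2 : i < w.1.1 := hw
    omega
  have key := B9Lemma21ShellCrossingZd.length_ge_of_levels hT hV hL hsep p.reverse w.2.1 hgap
  rw [SimpleGraph.Walk.length_reverse] at key
  have h1 : 1 ≤ w.1.1 - u.1.1 - 1 := by omega
  have h2 : R * ⌈x.M⌉₊ ≤ R * ⌈x.M⌉₊ * (w.1.1 - u.1.1 - 1) := Nat.le_mul_of_pos_right _ h1
  omega

/-! ## §3 Per-level packing: corners of level-`j` blocks run over `Lʲ·ℤᵈ` -/

/-- ★ **PER-LEVEL PACKING**: a finite set of level-`j` blocks whose corners `(Lʲz_μ)_μ` lie within sup-distance `ρ ≥ 0` of a point `p ∈ ℝᵈ` has at most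
`(2ρ∕Lʲ + 1)^d` elements — the block coordinate `z` is injective at fixed level and runs over the integer box `[⌈(p_μ − ρ)∕Lʲ⌉, ⌊(p_μ + ρ)∕Lʲ⌋]_μ`
(the engine's packing hypothesis with `A = 1`, `dd = d`; cf. `B6Ineq261LevelGap.pack_cube`). [cite: Balaban1984PropagatorsII, (2.58) p.233 («s(y) denotes a scaled image of y on unit lattice»); Balaban1985RegularSpaces, (1.28) p.81] -/
theorem pack_level (hL : 1 ≤ L) (j : ℕ) (p : Fin d → ℝ) (ρ : ℝ) (S : Finset (BSite L x)) (hρ : 0 ≤ ρ)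
    (hS : ∀ v ∈ S, v.1.1 = j ∧ dist (fun μ : Fin d => ((L : ℝ) ^ v.1.1 * (v.1.2 μ : ℝ))) p ≤ ρ) :
    (S.card : ℝ) ≤ (2 * ρ / (L : ℝ) ^ j + 1) ^ d := by
  classical
  set sℓ : ℝ := (L : ℝ) ^ j with hsℓ
  have hsℓ0 : 0 < sℓ := by
    have hL0 : (0 : ℝ) < L := by exact_mod_cast (lt_of_lt_of_le zero_lt_one hL)
    positivity
  -- the index box: z_μ ∈ [⌈(p_μ − ρ)/Lʲ⌉, ⌊(p_μ + ρ)/Lʲ⌋]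
  set lo : Fin d → ℤ := fun μ => ⌈(p μ - ρ) / sℓ⌉ with hlo
  set hi : Fin d → ℤ := fun μ => ⌊(p μ + ρ) / sℓ⌋ with hhi
  set B : Finset (Fin d → ℤ) := Fintype.piFinset fun μ => Finset.Icc (lo μ) (hi μ) with hB
  -- the coordinate map v ↦ z is injective on S (fixed level j) and lands in the box
  have hinj : Set.InjOn (fun v : BSite L x => v.1.2) S := by
    intro v hv w hw hvw
    have hv1 : v.1.1 = j := (hS v hv).1
    have hw1 : w.1.1 = j := (hS w hw).1
    apply Subtype.ext
    exact Prod.ext (hv1.trans hw1.symm) hvw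
  have hmaps : ∀ v ∈ S, (fun v : BSite L x => v.1.2) v ∈ B := by
    intro v hv
    obtain ⟨hz, hdist⟩ := hS v hv
    rw [hB, Fintype.mem_piFinset]
    intro μ
    rw [Finset.mem_Icc]
    have hcoord : dist ((L : ℝ) ^ v.1.1 * (v.1.2 μ : ℝ)) (p μ) ≤ ρ :=
      (dist_le_pi_dist (fun μ : Fin d => ((L : ℝ) ^ v.1.1 * (v.1.2 μ : ℝ))) p μ).trans hdist
    rw [Real.dist_eq, abs_le, hz] at hcoord
    constructor
    · rw [hlo]
      refine Int.ceil_le.mpr ?_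
      rw [div_le_iff₀ hsℓ0]
      linarith [hcoord.1]
    · rw [hhi]
      refine Int.le_floor.mpr ?_
      rw [le_div_iff₀ hsℓ0]
      linarith [hcoord.2]
  have hcardS : S.card ≤ B.card := Finset.card_le_card_of_injOn _ hmaps hinj
  -- the box has ≤ (2ρ/Lʲ + 1)^d points
  have hcoordcard : ∀ μ, ((Finset.Icc (lo μ) (hi μ)).card : ℝ) ≤ 2 * ρ / sℓ + 1 := by
    intro μ
    rw [Int.card_Icc]
    have h1 : ((hi μ + 1 - lo μ).toNat : ℝ) ≤ max ((hi μ : ℝ) + 1 - lo μ) 0 := by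
      rcases le_or_gt 0 (hi μ + 1 - lo μ) with h | h
      · have e : ((hi μ + 1 - lo μ).toNat : ℝ) = (hi μ : ℝ) + 1 - lo μ := by
          exact_mod_cast Int.toNat_of_nonneg h
        rw [e]; exact le_max_left _ _
      · rw [Int.toNat_eq_zero.mpr h.le]; push_cast; exact le_max_right _ _
    refine h1.trans (max_le ?_ (by positivity))
    have hhi' : (hi μ : ℝ) ≤ (p μ + ρ) / sℓ := Int.floor_le _
    have hlo' : (p μ - ρ) / sℓ ≤ (lo μ : ℝ) := Int.le_ceil _
    have : (p μ + ρ) / sℓ - (p μ - ρ) / sℓ = 2 * ρ / sℓ := by field_simp; ring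
    linarith
  have hBcard : (B.card : ℝ) ≤ (2 * ρ / sℓ + 1) ^ d := by
    rw [hB, Fintype.card_piFinset]
    push_cast
    calc ∏ μ : Fin d, ((Finset.Icc (lo μ) (hi μ)).card : ℝ) ≤ ∏ _μ : Fin d, (2 * ρ / sℓ + 1) :=
          Finset.prod_le_prod (fun μ _ => Nat.cast_nonneg _) (fun μ _ => hcoordcard μ)
      _ = (2 * ρ / sℓ + 1) ^ d := by rw [Finset.prod_const, Finset.card_univ, Fintype.card_fin]
  calc (S.card : ℝ) ≤ B.card := by exact_mod_cast hcardS
    _ ≤ (2 * ρ / sℓ + 1) ^ d := hBcard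

/-! ## §4 The member-uniform row letter (2.61) on the frame -/

include hT hV in
/-- ★★★ **[4] LEMMA 2.1 (2.61) ON THE `ℤᵈ` FRAME, MEMBER-UNIFORM CONSTANT** («sup_{y∈𝔅} Σ_{y′∈𝔅} e^{−αδ₀d(y,y′)} ≤ c₁(α) … RM satisfying (2.59)»).  For a member
`x` with `Sep22Zd R x`, laws (T)(V), `1 ≤ L`, CONNECTED block graph, and a threshold `N₀ ≥ 1` with `N₀ ≤ R·⌈M⌉` and `e^{−σ}·L^{2d∕N₀} < 1` (print's «RM sufficiently
large» at rate `σ`): for every block `y` and every finite set `S` of blocks, `Σ_{v∈S} e^{−σ·distZd(y,v)} ≤ K261 N₀ d L 1 σ` — the tree's generic (2.61) engine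
`B6Ineq261LevelGap.sum_exp_dist_le_max` at (zone = level, pos = corner `(Lʲz_μ)_μ ∈ ℝᵈ`, `ℓ(n) = Lⁿ`, `A = 1`), its three hypotheses being §1–§3.  The constant
depends on `(d, L, σ, N₀)` only: uniform over the family of members with `R⌈M⌉ ≥ N₀`. [cite: Balaban1984PropagatorsII, Lemma 2.1 (2.61) p.234, (2.59) p.233, (2.2) p.224, (2.46) p.231; Balaban1985BackgroundPropagators, p.397 (d(y, y′)), p.398 l.17–20] -/
theorem rowSum261_graphZd (hL : 1 ≤ L) {R : ℕ} (hsep : Sep22Zd R x) (hconn : ∀ u v : BSite L x, (graphZd L x).Reachable u v)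
    {σ : ℝ} {N₀ : ℕ} (hN₀ : 0 < N₀) (hMN : N₀ ≤ R * ⌈x.M⌉₊)
    (hθ : Real.exp (-σ) * (L : ℝ) ^ ((2 * d : ℝ) / N₀) < 1) (y : BSite L x) (S : Finset (BSite L x)) :
    ∑ v ∈ S, Real.exp (-(σ * distZd L x y v)) ≤ K261 N₀ d L 1 σ := by
  have hc : (graphZd L x).Connected := { preconnected := hconn, nonempty := ⟨y⟩ }
  have hL1 : (1 : ℝ) ≤ L := by exact_mod_cast hL
  have hL0 : (0 : ℝ) < L := by linarith
  have key := sum_exp_dist_le_max (G := graphZd L x) (zone := fun v : BSite L x => v.1.1)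
    (pos := fun (v : BSite L x) (μ : Fin d) => ((L : ℝ) ^ v.1.1 * (v.1.2 μ : ℝ))) (ℓ := fun n => (L : ℝ) ^ n)
    (dd := d) (Lr := (L : ℝ)) (A := 1) (σ := σ) (K := K261 N₀ d L 1 σ) hc (levelGap_graphZd hT hV hL hsep hMN) hN₀
    (fun u v h => dist_corner_le_of_adj hL h) (fun a b hab => pow_le_pow_right₀ hL1 hab) (fun n => pow_pos hL0 n)
    (fun n => (pow_succ' (L : ℝ) n).le) hL1 zero_le_one
    (fun j p ρ S hρ hS => pack_level hL j p ρ S hρ hS)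
    (fun R => partialSum_le_K261 hL0.le zero_le_one (summable_K261 hN₀ hL1 zero_le_one hθ) R) y S
  simpa only [distZd] using key

include hT hV in
/-- ★ **(2.61) ON THE FRAME, REGIME IN PRINT'S LOGARITHMIC SHAPE** «¼αδ₀RM > 2d log c₀(½α) + 1 (2.59)»: `2d·log L < σ·N₀` suffices for `e^{−σ}L^{2d∕N₀} < 1`
(`theta_lt_one_of_log`). [cite: Balaban1984PropagatorsII, (2.59) p.233, Lemma 2.1 (2.61) p.234] -/
theorem rowSum261_graphZd_of_log (hL : 1 ≤ L) {R : ℕ} (hsep : Sep22Zd R x) (hconn : ∀ u v : BSite L x, (graphZd L x).Reachable u v)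
    {σ : ℝ} {N₀ : ℕ} (hN₀ : 0 < N₀) (hMN : N₀ ≤ R * ⌈x.M⌉₊) (hreg : 2 * (d : ℝ) * Real.log L < σ * N₀)
    (y : BSite L x) (S : Finset (BSite L x)) :
    ∑ v ∈ S, Real.exp (-(σ * distZd L x y v)) ≤ K261 N₀ d L 1 σ :=
  rowSum261_graphZd hT hV hL hsep hconn hN₀ hMN
    (theta_lt_one_of_log (by exact_mod_cast (lt_of_lt_of_le zero_lt_one hL)) hN₀ hreg) y S

include hT hV in
/-- ★ **(2.61) ON THE FRAME WITH THE CONSTANT IN CLOSED FORM**: `Σ_{v∈S} e^{−σ·distZd(y,v)} ≤ 3·3^d·L^{2d}·(d+1)!∕(1 − θ)^{d+2}`, `θ = e^{−σ}·L^{2d∕N₀} < 1`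
(`K261_le_closedForm` at `A = 1`). [cite: Balaban1984PropagatorsII, Lemma 2.1 (2.61) p.234, (2.59) p.233] -/
theorem rowSum261_graphZd_closedForm (hL : 1 ≤ L) {R : ℕ} (hsep : Sep22Zd R x) (hconn : ∀ u v : BSite L x, (graphZd L x).Reachable u v)
    {σ : ℝ} {N₀ : ℕ} (hN₀ : 0 < N₀) (hMN : N₀ ≤ R * ⌈x.M⌉₊)
    (hθ : Real.exp (-σ) * (L : ℝ) ^ ((2 * d : ℝ) / N₀) < 1) (y : BSite L x) (S : Finset (BSite L x)) :
    ∑ v ∈ S, Real.exp (-(σ * distZd L x y v)) ≤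
      (3 * ((1 : ℝ) + 2) ^ d * (L : ℝ) ^ (2 * d)) * ((d + 1).factorial *
        (1 / (1 - Real.exp (-σ) * (L : ℝ) ^ ((2 * d : ℝ) / N₀)) ^ (d + 2))) :=
  (rowSum261_graphZd hT hV hL hsep hconn hN₀ hMN hθ y S).trans
    (K261_le_closedForm hN₀ (by exact_mod_cast hL) zero_le_one hθ)

include hT hV in
/-- ★ **THE ROW LETTER OF A FINITE MEMBER, MEMBER-UNIFORMLY**: on a finite member (`Fintype (BSite L x)`) with connected block graph, `Sep22Zd R x`, laws (T)(V),
`R⌈M⌉ ≥ N₀ ≥ 1`, `e^{−σ}L^{2d∕N₀} < 1`: `Σ_v e^{−σ·distZd(u,v)} ≤ K261 N₀ d L 1 σ` for every block `u` — the inhabitant of the row letter of the frame's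
local-to-global summations (`B9Eq347GlobalFromLocalZd`, `B9GraphZdBallGrowth.rowLetter_uniform_of_connected`'s print-regime replacement).
[cite: Balaban1984PropagatorsII, Lemma 2.1 (2.61) p.234; Balaban1985BackgroundPropagators, p.398 l.17–20] -/
theorem rowLetter261_univ [Fintype (BSite L x)] (hL : 1 ≤ L) {R : ℕ} (hsep : Sep22Zd R x)
    (hconn : ∀ u v : BSite L x, (graphZd L x).Reachable u v) {σ : ℝ} {N₀ : ℕ} (hN₀ : 0 < N₀) (hMN : N₀ ≤ R * ⌈x.M⌉₊)
    (hθ : Real.exp (-σ) * (L : ℝ) ^ ((2 * d : ℝ) / N₀) < 1) (u : BSite L x) :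
    ∑ v, Real.exp (-(σ * distZd L x u v)) ≤ K261 N₀ d L 1 σ :=
  rowSum261_graphZd hT hV hL hsep hconn hN₀ hMN hθ u Finset.univ

include hT hV in
/-- ★ **LITERALLY THE LETTER `hS` OF THE HÖLDER ∕ SUP SUMMATIONS** (`B9Eq343HolderBothZdFinite.holderBoth_msup_le_CH`, rate `δ₀ − κ₂`): on a finite member as in
`rowLetter261_univ`, `∀ u, Σ_v e^{−(δ₀ − κ₂)·distZd(u,v)} ≤ K261 N₀ d L 1 (δ₀ − κ₂)` once `e^{−(δ₀−κ₂)}L^{2d∕N₀} < 1` — the member-uniform `S`.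
[cite: Balaban1984PropagatorsII, Lemma 2.1 (2.61) p.234; Balaban1985BackgroundPropagators, (3.43), (3.47) p.398 + l.17–20] -/
theorem rowLetter261_hS [Fintype (BSite L x)] (hL : 1 ≤ L) {R : ℕ} (hsep : Sep22Zd R x)
    (hconn : ∀ u v : BSite L x, (graphZd L x).Reachable u v) {δ₀ κ₂ : ℝ} {N₀ : ℕ} (hN₀ : 0 < N₀) (hMN : N₀ ≤ R * ⌈x.M⌉₊)
    (hθ : Real.exp (-(δ₀ - κ₂)) * (L : ℝ) ^ ((2 * d : ℝ) / N₀) < 1) :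
    ∀ u : BSite L x, ∑ v, Real.exp (-((δ₀ - κ₂) * distZd L x u v)) ≤ K261 N₀ d L 1 (δ₀ - κ₂) :=
  fun u => rowLetter261_univ hT hV hL hsep hconn hN₀ hMN hθ u

end Literature.MathematicalPhysics.QuantumFieldTheory.Balaban1983to89.B9Lemma21RowLetterZd
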